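import Summits.Ventures.CertifiedManyBodySolver.Certificates.HubbardSquare_cellword_Kit
import HarnessLib

/-!
# Ventures/CertifiedManyBodySolver — Certificates/HubbardSquare_cellword_KitN1.lean (hubbard-box-eng-2 g3, cell hubbard-fast)

HONEST FRAMING: transport bookkeeping of certified ground-state-energy bounds; not a superconductivity verdict; not a
pairing bound; no number is certified in this file — it holds the two GENERIC composition lemmas for census-CELL kernel
words whose filling slab STRADDLES HALF FILLING, `n ∈ [n₁, n₂]` with `0 < n₁ < 1 < n₂ < 2` (the parent-compound material
boxes, e.g. La₂CuO₄ `n ∈ [0.99, 1.01]`), complementing `HubbardSquare_cellword_Kit` (slabs inside `(0,1)`):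
* `cell_node_floor_n1` — a node floor `L ≤ e(1,t′,U,1)` AT half filling gives the slab floor
  `min ((2 − n₁)L − U(1 − n₁)) (min L (n₂ L))`: midpoint convexity in `n` at `1` between `m` and `2 − m`, the particle–hole
  identity `e(t′, 2 − m) = e(−t′, m) + U(1 − m)` (`energyDensityTT'_particleHole`), the vacuum chord `e(−t′,m) ≤ m·e(−t′,1)`
  and evenness `e(−t′,1) = e(t′,1)` (`energyDensityTT'_particleHole_one`) give `(2 − m)L − U(1 − m) ≤ e(t′,m)` for `m < 1`;
  above half filling the same identity gives `n·L ≤ e(t′,n)`;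
* `cell_slab_cap_n1` — a cap `e(1,0,U',1) ≤ C` at half filling (`U ≤ U'`) gives the slab cap
  `max (max (n₁ C) C) (max ((2 − n₂) C) C + U (n₂ − 1))`: evenness + concavity in `t′` (`box3d_halfFilling_cap_of_tp0`),
  the vacuum chord and convexity below half filling, and the particle–hole identity above it;
  `cell_slab_cap_n1_le` — the same with the particle–hole term read at a cell's upper end `U_b` (closed literals);
The loss `U·|n − 1|` is the exact particle–hole term, i.e. the Mott jump of the chemical potential times the slab half-width:
a uniform pair over a slab straddling `n = 1` cannot avoid it.
-/

noncomputable section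

namespace Summit.Ventures.CertifiedManyBodySolver.Certificates

open Matrix Finset Filter Topology
open Literature.MathematicalPhysics.QuantumLattice
open Literature.MathematicalPhysics.QuantumLattice.ThermodynamicLimit
open Literature.Probability.LatticeModels
open scoped ComplexOrder ComplexConjugate Topology BigOperators

/-- **Below half filling, from a half-filling floor.** `L ≤ e(1,s,U,1)`, `0 < m < 1`, `0 ≤ U` give
`(2 − m) L − U (1 − m) ≤ e(1,s,U,m)`: midpoint convexity at `n = 1` between `m` and `2 − m` (`convexOn_energyDensityTT'`), the
particle–hole identity at `2 − m` (`energyDensityTT'_particleHole`), the vacuum chord at hopping `−s`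
(`energyDensityTT'_le_vacuum_chord`) and evenness at half filling (`energyDensityTT'_particleHole_one`).
[cite: LiebWuPhysicaA2003, §1 eq. (3)] -/
theorem cell_floor_below_halfFilling {s U L m : ℝ} (hU : 0 ≤ U) (hm0 : 0 < m) (hm1 : m < 1)
    (hL : L ≤ energyDensityTT' 1 s U 1) :
    (2 - m) * L - U * (1 - m) ≤ energyDensityTT' 1 s U m := by
  have hc := (convexOn_energyDensityTT' 1 s hU).2 (show m ∈ Set.Ico (0:ℝ) 2 from ⟨hm0.le, by linarith⟩)
    (show (2 - m) ∈ Set.Ico (0:ℝ) 2 from ⟨by linarith, by linarith⟩)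
    (show (0:ℝ) ≤ 1/2 by norm_num) (show (0:ℝ) ≤ 1/2 by norm_num) (show (1/2:ℝ) + 1/2 = 1 by norm_num)
  simp only [smul_eq_mul] at hc
  rw [show (1/2:ℝ) * m + 1/2 * (2 - m) = 1 by ring] at hc
  have hph := energyDensityTT'_particleHole 1 s hU (n := 2 - m) (by linarith) (by linarith)
  rw [show (2:ℝ) - (2 - m) = m by ring] at hph
  have hv := energyDensityTT'_le_vacuum_chord 1 (-s) hU (n := m) (n₂ := 1) hm0 hm1 (by norm_num) le_rfl
  rw [energyDensityTT'_particleHole_one 1 s hU, div_one] at hv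
  have hL' := mul_le_mul_of_nonneg_left hL (by linarith : (0:ℝ) ≤ 2 - m)
  nlinarith [hc, hph, hv, hL']

/-- **Slab floor at a half-filling node.** From a floor `L ≤ e(1,t′,U,1)` (`0 ≤ U`) and a slab `[n₁, n₂]` with
`0 < n₁ < 1`, `n₂ < 2`: for every `n` of the slab, `min ((2 − n₁) L − U (1 − n₁)) (min L (n₂ L)) ≤ e(1,t′,U,n)`
(`cell_floor_below_halfFilling` at hopping `t′` below half filling, and at hopping `−t′` composed with the particle–hole
identity above it: `e(t′,n) = e(−t′,2 − n) + U(n − 1) ≥ n L`; the three entries are the values of these affine floors at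
`n₁`, `1`, `n₂`). [cite: LiebWuPhysicaA2003, §1 eq. (3)] -/
theorem cell_node_floor_n1 {t' U L n₁ n₂ : ℝ} (hU : 0 ≤ U) (hn₁ : 0 < n₁) (h₁ : n₁ < 1)
    (hn₂ : n₂ < 2) (hL : L ≤ energyDensityTT' 1 t' U 1) {n : ℝ} (hn : n ∈ Set.Icc n₁ n₂) :
    min ((2 - n₁) * L - U * (1 - n₁)) (min L (n₂ * L)) ≤ energyDensityTT' 1 t' U n := by
  rcases le_total n 1 with hle | hge
  · rcases eq_or_lt_of_le hle with heq | hlt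
    · rw [heq]; exact (min_le_right _ _).trans ((min_le_left _ _).trans hL)
    have key := cell_floor_below_halfFilling (s := t') hU (by linarith [hn.1]) hlt hL
    rcases le_total L U with hLU | hUL
    · refine (min_le_left _ _).trans (le_trans ?_ key)
      nlinarith [mul_nonneg (sub_nonneg.2 hn.1) (sub_nonneg.2 hLU)]
    · refine (min_le_right _ _).trans ((min_le_left _ _).trans (le_trans ?_ key))
      nlinarith [mul_nonneg (sub_nonneg.2 hle) (sub_nonneg.2 hUL)]
  · rcases eq_or_lt_of_le hge with heq | hgt
    · rw [← heq]; exact (min_le_right _ _).trans ((min_le_left _ _).trans hL)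
    have hn2' : n < 2 := by linarith [hn.2]
    have hph := energyDensityTT'_particleHole 1 t' hU (n := n) (by linarith) hn2'
    have hL1 : L ≤ energyDensityTT' 1 (-t') U 1 := by rwa [energyDensityTT'_particleHole_one 1 t' hU]
    have key := cell_floor_below_halfFilling (s := -t') hU (m := 2 - n) (by linarith) (by linarith) hL1
    have hnL : n * L ≤ energyDensityTT' 1 t' U n := by rw [hph]; nlinarith [key]
    rcases le_total L 0 with hL0 | hL0
    · refine (min_le_right _ _).trans ((min_le_right _ _).trans (le_trans ?_ hnL))
      nlinarith [mul_nonneg (sub_nonneg.2 hn.2) (neg_nonneg.2 hL0)]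
    · refine (min_le_right _ _).trans ((min_le_left _ _).trans (le_trans ?_ hnL))
      nlinarith [mul_nonneg (sub_nonneg.2 hge) hL0]

/-- **Below half filling, from a half-filling cap at any hopping.** If `e(1,s,U,1) ≤ C` for EVERY hopping `s` (`0 ≤ U`),
then for `0 < a < 1` and every `m ∈ [a, 1]`: `e(1,s,U,m) ≤ max (a C) C` (vacuum chord at `a`, convexity on `[a,1]`).
[cite: Ruelle1969, §3.3] -/
theorem cell_cap_below_halfFilling {U C : ℝ} (hU : 0 ≤ U) (h1 : ∀ s : ℝ, energyDensityTT' 1 s U 1 ≤ C)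
    (s : ℝ) {a m : ℝ} (ha : 0 < a) (ha1 : a < 1) (hm : m ∈ Set.Icc a 1) :
    energyDensityTT' 1 s U m ≤ max (a * C) C := by
  have hv := energyDensityTT'_le_vacuum_chord 1 s hU (n := a) (n₂ := 1) ha ha1 (by norm_num) (h1 s)
  rw [div_one] at hv
  exact energyDensityTT'_le_max_of_mem_Icc 1 s hU (m₁ := a) (m₂ := 1) ha.le (by norm_num) hv (h1 s) hm

/-- **Slab cap around half filling from a half-filling cap.** A cap `e(1,0,U',1) ≤ C` (`0 ≤ U ≤ U'`) gives, for every `t′`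
and every `n ∈ [n₁, n₂]` with `0 < n₁ < 1 < n₂ < 2`:
`e(1,t′,U,n) ≤ max (max (n₁ C) C) (max ((2 − n₂) C) C + U (n₂ − 1))` — monotonicity in `U`, evenness + concavity in `t′`
at half filling (`box3d_halfFilling_cap_of_tp0`), `cell_cap_below_halfFilling` below half filling, and the particle–hole
identity `e(t′,n) = e(−t′,2 − n) + U(n − 1)` above it. [cite: LiebWuPhysicaA2003, §1 eq. (3)] -/
theorem cell_slab_cap_n1 {U U' C n₁ n₂ : ℝ} (hU : 0 ≤ U) (hUU' : U ≤ U') (hC : energyDensityTT' 1 0 U' 1 ≤ C)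
    (hn₁ : 0 < n₁) (h₁ : n₁ < 1) (h₂ : 1 < n₂) (hn₂ : n₂ < 2) (t' : ℝ)
    {n : ℝ} (hn : n ∈ Set.Icc n₁ n₂) :
    energyDensityTT' 1 t' U n ≤ max (max (n₁ * C) C) (max ((2 - n₂) * C) C + U * (n₂ - 1)) := by
  have hm : energyDensityTT' 1 0 U 1 ≤ energyDensityTT' 1 0 U' 1 :=
    energyDensityTT'_mono_U 1 0 (n := 1) (by norm_num) (by norm_num) hU hUU'
  have h1 : ∀ s : ℝ, energyDensityTT' 1 s U 1 ≤ C := fun s => box3d_halfFilling_cap_of_tp0 hU (hm.trans hC) s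
  rcases le_total n 1 with hle | hge
  · exact (cell_cap_below_halfFilling hU h1 t' hn₁ h₁ ⟨hn.1, hle⟩).trans (le_max_left _ _)
  · have hn0 : 0 < n := by linarith
    have hn2' : n < 2 := by linarith [hn.2]
    have hph := energyDensityTT'_particleHole 1 t' hU hn0 hn2'
    have hb := cell_cap_below_halfFilling hU h1 (-t') (a := 2 - n₂) (m := 2 - n) (by linarith) (by linarith)
      ⟨by linarith [hn.2], by linarith⟩
    have hUn : U * (n - 1) ≤ U * (n₂ - 1) := mul_le_mul_of_nonneg_left (by linarith [hn.2]) hU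
    calc energyDensityTT' 1 t' U n = energyDensityTT' 1 (-t') U (2 - n) + U * (n - 1) := hph
      _ ≤ max ((2 - n₂) * C) C + U * (n₂ - 1) := add_le_add hb hUn
      _ ≤ _ := le_max_right _ _

/-- **Slab cap around half filling, closed form on a U-cell.** `cell_slab_cap_n1` with the particle–hole term bounded at the
cell's upper end `U ≤ U_b ≤ U'` and the sum distributed over the `max`:
`e(1,t′,U,n) ≤ max (max (n₁ C) C) (max ((2 − n₂) C + U_b (n₂ − 1)) (C + U_b (n₂ − 1)))` — four closed literals once
`C, U_b, n₁, n₂` are numerals. [cite: LiebWuPhysicaA2003, §1 eq. (3)] -/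
theorem cell_slab_cap_n1_le {U Ub U' C n₁ n₂ : ℝ} (hU : 0 ≤ U) (hUb : U ≤ Ub) (hUbU' : Ub ≤ U')
    (hC : energyDensityTT' 1 0 U' 1 ≤ C) (hn₁ : 0 < n₁) (h₁ : n₁ < 1) (h₂ : 1 < n₂) (hn₂ : n₂ < 2) (t' : ℝ)
    {n : ℝ} (hn : n ∈ Set.Icc n₁ n₂) :
    energyDensityTT' 1 t' U n ≤
      max (max (n₁ * C) C) (max ((2 - n₂) * C + Ub * (n₂ - 1)) (C + Ub * (n₂ - 1))) := by
  refine (cell_slab_cap_n1 hU (hUb.trans hUbU') hC hn₁ h₁ h₂ hn₂ t' hn).trans ?_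
  have hm : U * (n₂ - 1) ≤ Ub * (n₂ - 1) := mul_le_mul_of_nonneg_right hUb (by linarith)
  refine max_le_max le_rfl ?_
  rw [max_add_add_right]
  linarith [hm]

end Summit.Ventures.CertifiedManyBodySolver.Certificates

end
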